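/-
Origin: expansion seat `planner-pub-hodgecm-carver-g2-0`, handover v2 2026-08-18 (`HOME/pub-hodgecm-carver-g2/lean/CarverG2/PerL34/AssemblyDict.lean`, md5 03977e9e, 81 lines);
landed by the gen-6 packager in gate run 22 as `HodgeCM/PerL34/AssemblyDict.lean` (import ^import Pv[0-9]+g[0-9]+\.PerL34\.→import HodgeCM.PerL34. ×1; import ^import Pv[0-9]+\.→import HodgeCM.PerL34. ×1).
-/
/-
Copyright: publication cell pub-hodgecm (THE CARVER gen 2, planner-pub-hodgecm-carver-g2-0). Lean 4 / Mathlib.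

# `AssemblyDict` — PerL from the DICTIONARY-LEVEL leaves (LEMMAS.md v6 §9: seams S1, S2, S5-(12) closed down to
named dictionary fields; additive successor of `AssemblyLeaves` v2)

v2 (import-only rebase, 04:45Z): `HodgeCM.PerL34.AssemblyLeaves` is the LANDED run-21 module (carver v2 be52db9b);
WIP imports left (PACKAGER: rewrite the two seat-prefixed imports to the run-22 landed names:
`Pv02g2.PerL34.CharSpans` → `HodgeCM.PerL34.CharSpans` (pv02-g2 9c9ff4da),
`Pv11.SeesawDictionary` → `HodgeCM.PerL34.SeesawDictionary` (pv11 f942ea4b)).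

NOTHING is cited or posited here: three theorems, all one-line compositions of landed/handed theorems.

* `N33_wedge_of_charSpans`  : `ClusterOutputs T → CharSpans.CharSpanStepsInput T → N33_wedge T`
  (seam S1 = pv03 `BallSpans` v6 + pv14 `P43FrameBall`/`P43Frame` + seam S2 = pv02-g2 `CharSpans`; `LevelDirected` and
  `N33eClosed` discharged in-package).  Residual per good context (V,c): `∃ M : CharLineSpans T V c, M.Inputs` =
  pv02's five group-input Props (LeftInvariant, CompactInvariant, FiniteStable, UHolomorphic, SomeNonzero) ∧ `HolFromBall`
  (DEFINITIONAL D2/D6) ∧ `Dense Δ` (PRINT: weak approximation for the simply connected SU, [Borovoi 0804.4767 Cor 3.13]) ∧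
  `Dict_thetaClass₀` ∧ `Dict_thetaClass₁` (DEFINITIONAL D1/D2) ∧ `Dict_cupWedge` (PRINT/DEFINITIONAL).
* `N19w_wedgeMem_of_bridges` : seesaw bridges at every good context + `ClusterOutputs T` ⟹ `N19w_wedgeMem T`
  (seam S5, (12)-half = pv11 `SeesawDictionary`: residual = the two dictionary fields `Λ_wedge` (D5) and `ϑ_period`
  (D4/D5) of `SeesawBridge` + its lattice-shell set-up and the N17 hypotheses of `SeesawWedge.genIdentity_core`).
* `perL_of_dictLeaves` : `U.PerL` from the node leaves with S1, S2, S3 (via `ClusterOutputs`), S4 (via `ArchCDatum`),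
  S5-(12) (via bridges) fed BY NAME; remaining binders = `N07/N09a/N09b/N12a/N12b` (PRINT leaves), `hcore` (S5 (34)-half,
  model-level `N19g_core`), `Pc/A12/A34` (S4 archimedean data), `h31 : ClusterOutputs T` (S3), `h33` (S1+S2 residual above).
-/
import Summits.HodgeConjecture.HodgeCM.PerL34.AssemblyLeaves
import Summits.HodgeConjecture.HodgeCM.PerL34.CharSpans
import Summits.HodgeConjecture.HodgeCM.PerL34.SeesawDictionary

/-! PORT of `HodgeCM/PerL34/AssemblyDict.lean` (HodgeCMPerL run 82) — verbatim mechanical port; provenance in the PORT header line. -/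

set_option autoImplicit false

noncomputable section

namespace HodgeCM
namespace PerL34

open HodgeCM.Prior.Perl34File HodgeCM.Prior.Perl34File.Perl34 HodgeCM.PerL34.ArchC

variable {U : Universe}

/-- **N33 BY NAME over the character-indexed ball-span model** (seams S1 + S2 closed down to dictionary fields):
pv02-g2 `CharSpans.open_thetaWedge_of_cluster` with `N33eClosed` discharged by pv01's `N33e_holds`. -/
theorem N33_wedge_of_charSpans (T : U.ThetaModel) (h31 : ClusterOutputs T)
    (h33 : CharSpans.CharSpanStepsInput T) : N33_wedge T :=
  (N33_iff T).mpr (CharSpans.open_thetaWedge_of_cluster T n33eClosed_holds h31 h33)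

/-- **N19w BY NAME from seesaw bridges** (seam S5, (12)-half): pv11 `SeesawDictionary.open_thetaGen12_of_bridges`
with `Open_chars` supplied by pv13's cluster outputs. -/
theorem N19w_wedgeMem_of_bridges (T : U.ThetaModel)
    (hbr : ∀ {L : CMField} {ι₁ : L →+* ℂ} (V : HermSpace3 L ι₁) (c : SeesawCtx L), T.GoodCtx ι₁ c →
      Nonempty (SeesawDictionary.SeesawBridge T V c (T.t12 V c) 0 1))
    (h31 : ClusterOutputs T) : N19w_wedgeMem T :=
  SeesawDictionary.open_thetaGen12_of_bridges T hbr (open_chars_of_cluster T h31)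

/-- **PerL from the dictionary-level leaves (LEMMAS.md v6 §9).**  PROVED; every binder is either a PRINT leaf
(`h07 h09a h09b h12a h12b`), archimedean Lemma-4.1(c) data (`Pc A12 A34`, seam S4), the model-level (34)-core
(`hcore`, seam S5 (34)-half), pv13's cluster outputs (`h31`, seam S3), seesaw bridges (`hbr`, seam S5 (12)-half:
two dictionary fields), or the character-indexed ball-span inputs (`h33`, seams S1+S2: dictionary fields + `Dense Δ`). -/
theorem perL_of_dictLeaves (M : U.ModelAxioms) (T : U.ThetaModel)
    (h07 : N07_hodgeRiemann20 U) (h09a : N09a_embCover T) (h09b : N09b_innerEmb T)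
    (h12a : N12a_thetaSub T) (h12b : N12b_signRecipe T)
    (hbr : ∀ {L : CMField} {ι₁ : L →+* ℂ} (V : HermSpace3 L ι₁) (c : SeesawCtx L), T.GoodCtx ι₁ c →
      Nonempty (SeesawDictionary.SeesawBridge T V c (T.t12 V c) 0 1))
    (hcore : ∀ {L : CMField} {ι₁ : L →+* ℂ} (V : HermSpace3 L ι₁) (c : SeesawCtx L), T.GoodCtx ι₁ c →
      N19g_core T V c (T.t34 V c) 2 3)
    (Pc : ∀ {L : CMField} {ι₁ : L →+* ℂ} (V : HermSpace3 L ι₁) (c : SeesawCtx L),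
      C4a.PointedCore (T.core V c))
    (A12 : ∀ {L : CMField} {ι₁ : L →+* ℂ} (V : HermSpace3 L ι₁) (c : SeesawCtx L),
      T.GoodCtx ι₁ c → Nonempty (ArchCDatum (T.core V c) (T.t12 V c) (Pc V c)))
    (A34 : ∀ {L : CMField} {ι₁ : L →+* ℂ} (V : HermSpace3 L ι₁) (c : SeesawCtx L),
      T.GoodCtx ι₁ c → Nonempty (ArchCDatum (T.core V c) (T.t34 V c) (Pc V c)))
    (h31 : ClusterOutputs T) (h33 : CharSpans.CharSpanStepsInput T) : U.PerL :=
  perL_of_nodes'' M T h07 h09a h09b h12a h12b (N19w_wedgeMem_of_bridges T hbr h31)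
    (N19g_genInWedgeSpan_of_core T hcore) (N29_occ_of_archC T Pc A12 A34) (N31_chars_of_cluster T h31)
    (N33_wedge_of_charSpans T h31 h33)

end PerL34
end HodgeCM

end
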